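import Summits.BirchSwinnertonDyer.Rank1Residual.Additive.BudgetFromTamagawaCertificatesLayerAll
import Summits.BirchSwinnertonDyer.Rank1Residual.Additive.BudgetFromTamagawaWitnessesJoint
import Summits.BirchSwinnertonDyer.Rank1Residual.Additive.KummerSelmerRestrictionInjective
import HarnessLib

/-!
# The JOINT Route-G budget at LAYER `n` from census certificates over `ℚ`:
# `BudgetLeLambdaAt p W (s + Σ_{v ∈ S} p^{min(n, m_v)})` (row T-E3g-JOINT, FILE J-C2 = r2's
# ST-21.2 'JOINT-n' in its exact shape; seat p10 GEN 5)

HONEST FRAMING (cell `b2b-bsdres`, run/shared/lean/b2b/bsd-rank1-residual/, verbatim in every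
file): the goal of the cell is to DELETE the COMBINATION-SHAPED residual classes of the
Birch–Swinnerton-Dyer formula for ALL analytic-rank `≤ 1` elliptic curves over `ℚ` — "full BSD
formula for every rank `≤ 1` curve in class `C`" assembled STRICTLY from published theorems — so
that the rank-`≤ 1` remainder becomes exactly the CONSTRUCTION-SHAPED classes, which are TYPED
(missing-input `Prop`s), NOT attempted. This is not "finishing BSD". Team n1011 (N10/N11, the
Route-G LOWER budget node of the CONSTRUCTION-SHAPED classes X3♯/X4♯): research route; a
SIZING / supplier theorem, OPTIONAL per ROUTE-2 II.20/II.21 (no named customer today: the 11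
`b₀ = 3` rows of II.20.3 are level-`0`-full and served by `BudgetFromTamagawaWitnessesJoint`);
nothing is booked by this file; no mark / label moved. THEOREMS ONLY: no definition, no named
fact, no `sorry`; census literals enter as HYPOTHESES per row.

## What

The MAIN of record (`budgetLeLambdaAt_layer_of_certificates`, p277136) counts, at layer `n`, the
Tamagawa witnesses at the places of `ℚ_n` above `S`: `Σ_{v ∈ S} p^{min(n, m_v)}`.  The JOINT count
(`BudgetFromRelaxedKummerCountJoint`, over ANY number field) adds the STRICT Selmer classes — the
classes of `Sel_p(E_{ℚ_n}/ℚ_n)` locally trivial at those places.  The strict classes over `ℚ`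
RESTRICT to strict classes over `ℚ_n` (`KummerSelmerRestriction`: Selmer to Selmer, strict to
strict), injectively when `E(ℚ)[p] = 0` (`KummerSelmerRestrictionInjective`).  Hence:

* `natCard_strict_le_natCard_strict_baseChange` — for a number field `K`, an extension `L` with
  `resBaseChangeTorsion` injective, a finite set `S` of places of `K` and a finite set `T` of places
  of `L` lying over `S`: `#S₀(E/K, S) ≤ #S₀(E_L/L, T)`;
* `exists_finset_selmerInfty_torsion_joint_layer` — over `ℚ_n`: `p^{#T₀ + s}` classes of
  `Sel_{p^∞}(E/ℚ_∞)[p]` from `#T₀` witness places of `ℚ_n` over `S` and `p^s` strict classes over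
  `ℚ`;
* **`budgetLeLambdaAt_layer_of_certificates_joint (hodd) (h414) (htors) (hU) (n) (hPT) (hEP) (S) (m)
  (hSp) (hval) (hcv) (hdat) (s) (hSel : p ^ s ≤ #{x ∈ Sel_p(E/ℚ) : loc_v x = 0, v ∈ S}) :
  BudgetLeLambdaAt p W (s + Σ_{v ∈ S} p^{min(n, m_v)})`** — r2's ST-21.2 shape: the MAIN's
  binders (Greenberg 4.14, Poitou–Tate and local Euler–Poincaré over `ℚ_n`, A40 on split rows)
  plus the ℚ-level census literal `hSel`; `hres` by row T-res (n1011-p17) by name.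

HONEST LIMITS: lower bound only; the strict classes are those over `ℚ` (counted once, not per
layer); one inequality per layer; at `n = 0` this is `budgetLeLambdaAt_of_certificates_joint`.

References: R. Greenberg, LNM 1716 (1999) §5 pp. 114–118 and Prop. 4.14 [GreenbergLNM1716];
J.-P. Serre, *Galois Cohomology* I.§2; ROUTE-2 II.18.4 / II.21 (cells/n1011/).
-/

set_option autoImplicit false

noncomputable section

open scoped Classical

open Function Field NumberField IsDedekindDomain WeierstrassCurve
open Literature.NumberTheory.EllipticCurves Literature.NumberTheory.GaloisRepresentations
open Literature.NumberTheory.GaloisRepresentations.DiscreteGaloisModule (SelmerStructure unramifiedSubgroup)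
open Literature.NumberTheory.GaloisCohomology

namespace Summit.BirchSwinnertonDyer.Rank1Residual.Additive

universe u

/-! ### §1 Strict Selmer classes restrict to strict Selmer classes -/

section Strict

variable {K : Type u} [Field K] [NumberField K] (W : WeierstrassCurve K) [W.IsElliptic]
  (L : Type u) [Field L] [NumberField L] [Algebra K L] [(W.baseChange L).IsElliptic] {p : ℕ}
  [hp : Fact p.Prime]

/-- **`#S₀(E/K, S) ≤ #S₀(E_L/L, T)`**: for an extension `L/K` of number fields along which
`resBaseChangeTorsion` is injective, a finite set `S` of places of `K` and a finite set `T` of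
places of `L` all lying over `S`, the Selmer classes of `E[p]` over `K` locally trivial on `S`
inject into the Selmer classes of `E_L[p]` over `L` locally trivial on `T`
(`resBaseChangeTorsion_mem_selmerGroup`, `localization_resBaseChangeTorsion_eq_zero`). [folklore] -/
theorem natCard_strict_le_natCard_strict_baseChange
    (hinj : Injective (resBaseChangeTorsion W L (n := (p : ℤ)) (by exact_mod_cast hp.out.ne_zero)))
    (S : Finset (HeightOneSpectrum (𝓞 K))) (T : Finset (HeightOneSpectrum (𝓞 L)))
    (hT : ∀ w ∈ T, w.under (𝓞 K) ∈ S)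
    (hfin : Finite ((W.baseChange L).kummerSelmerStructure (p : ℤ)).selmerGroup) :
    Nat.card {x : (W.kummerSelmerStructure (p : ℤ)).selmerGroup //
        ∀ v ∈ S, galoisCohomology.localization (W.torsionGaloisModule (p : ℤ)) (Sum.inr v) 1
          (x : galoisCohomology (W.torsionGaloisModule (p : ℤ)) 1) = 0} ≤
      Nat.card {x : ((W.baseChange L).kummerSelmerStructure (p : ℤ)).selmerGroup //
        ∀ w ∈ T, galoisCohomology.localization ((W.baseChange L).torsionGaloisModule (p : ℤ))
          (Sum.inr w) 1
          (x : galoisCohomology ((W.baseChange L).torsionGaloisModule (p : ℤ)) 1) = 0} := by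
  have hn : (p : ℤ) ≠ 0 := by exact_mod_cast hp.out.ne_zero
  let f : {x : (W.kummerSelmerStructure (p : ℤ)).selmerGroup //
        ∀ v ∈ S, galoisCohomology.localization (W.torsionGaloisModule (p : ℤ)) (Sum.inr v) 1
          (x : galoisCohomology (W.torsionGaloisModule (p : ℤ)) 1) = 0} →
      {x : ((W.baseChange L).kummerSelmerStructure (p : ℤ)).selmerGroup //
        ∀ w ∈ T, galoisCohomology.localization ((W.baseChange L).torsionGaloisModule (p : ℤ))
          (Sum.inr w) 1
          (x : galoisCohomology ((W.baseChange L).torsionGaloisModule (p : ℤ)) 1) = 0} :=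
    fun x ↦ ⟨⟨resBaseChangeTorsion W L hn x.1.1,
        resBaseChangeTorsion_mem_selmerGroup W L hn x.1.2⟩,
      fun w hw ↦ localization_resBaseChangeTorsion_eq_zero W L hn rfl (x.2 _ (hT w hw))⟩
  have hf : Injective f := fun x y h ↦
    Subtype.ext (Subtype.ext (hinj (congrArg (fun z ↦ z.1.1) h)))
  haveI := hfin
  haveI : Finite {x : ((W.baseChange L).kummerSelmerStructure (p : ℤ)).selmerGroup //
      ∀ w ∈ T, galoisCohomology.localization ((W.baseChange L).torsionGaloisModule (p : ℤ))
        (Sum.inr w) 1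
        (x : galoisCohomology ((W.baseChange L).torsionGaloisModule (p : ℤ)) 1) = 0} :=
    Subtype.finite
  exact Nat.card_le_card_of_injective f hf

end Strict

/-! ### §2 The joint classes at layer `n` -/

section Layer

variable {W : WeierstrassCurve ℚ} [W.IsElliptic] {p : ℕ} [hp : Fact p.Prime]

/-- **`#T₀` witnesses over `ℚ_n` above `S` and `p^s` strict classes over `ℚ` give `p^{#T₀ + s}`
classes of `Sel_{p^∞}(E/ℚ_∞)[p]`** for the cyclotomic `κ` (the joint twin of N2's
`exists_finset_selmerInfty_torsion_of_tamagawaWitnesses_layer`): the strict classes restrict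
injectively to strict-at-`T₀` classes over `ℚ_n` (`E(ℚ)[p] = 0`), FILE J-B's K-general socket over
`ℚ_n` counts, and row T-res' transport carries `A'_0[p]` into `Sel_{p^∞}(E/ℚ_∞)[p]`.
[cite: GreenbergLNM1716, §5 pp. 114–118] -/
theorem exists_finset_selmerInfty_torsion_joint_layer (hodd : p ≠ 2)
    (htors : ¬ p ∣ W.torsionOrder) (κ : ZpExtension ℚ p) (hκ : κ.IsCyclotomic) (n : ℕ)
    [NumberField (κ.layer n)] (κ' : ZpExtension (κ.layer n) p)
    (hκ' : ∀ σ : absoluteGaloisGroup (κ.layer n),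
      (κ' σ).toAdd * (p : ℤ_[p]) ^ n = (κ (resGal (K := ℚ) (κ.layer n) σ)).toAdd)
    (f : (W.baseChange (κ.layer n)).selmerInfty κ' →+ W.selmerInfty κ) (hf : Injective f)
    (inv : LocalInvariants (κ.layer n) p) (hperf : inv.IsPerfect) (hsum : inv.SumLocalTermEqZero)
    (hcompl : inv.SelmerComplement)
    (hEP : ∀ w : HeightOneSpectrum (𝓞 (κ.layer n)),
      localEulerPoincareCharacteristic (w.adicCompletion (κ.layer n)))
    (S : Finset (HeightOneSpectrum (𝓞 ℚ))) (T₀ : Finset (HeightOneSpectrum (𝓞 (κ.layer n))))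
    (hT₀S : ∀ w ∈ T₀, w.under (𝓞 ℚ) ∈ S)
    (hT₀p : ∀ w ∈ T₀, ((p : ℕ) : 𝓞 (κ.layer n)) ∉ w.asIdeal)
    (hwit : ∀ w ∈ T₀, ∃ u ∈ unramifiedSubgroup
        (((W.baseChange (κ.layer n)).torsionGaloisModule (p : ℤ)).restrictField
          (w.adicCompletion (κ.layer n))) 1,
      u ∉ (W.baseChange (κ.layer n)).kummerLocalConditionAt (p : ℤ) (w.adicCompletion (κ.layer n)))
    (s : ℕ) (hSel : p ^ s ≤ Nat.card {x : (W.kummerSelmerStructure (p : ℤ)).selmerGroup //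
      ∀ v ∈ S, galoisCohomology.localization (W.torsionGaloisModule (p : ℤ)) (Sum.inr v) 1
        (x : galoisCohomology (W.torsionGaloisModule (p : ℤ)) 1) = 0}) :
    ∃ t : Finset {y : W.selmerInfty κ // p • y = 0}, p ^ (T₀.card + s) ≤ t.card := by
  haveI : NeZero p := ⟨hp.out.ne_zero⟩
  haveI : (W.baseChange (κ.layer n)).IsElliptic := by rw [WeierstrassCurve.baseChange]; infer_instance
  have hK' : ∀ Q : (W.baseChange (κ.layer n)).toAffine.Point, p • Q = 0 → Q = 0 :=
    forall_smul_eq_zero_baseChange_layer W p κ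
      (fun P hP ↦ forall_smul_eq_zero_of_not_dvd_torsionOrder W p htors P (by convert hP)) n
  have hκ'c : κ'.IsCyclotomic := isCyclotomic_restrictTower κ hκ (κ.layer n) κ' n hκ'
  -- the strict classes over `ℚ_n`: at least `p^s` of them, when finitely many
  have hS₀' : p ^ s ≤ Nat.card {x : ((W.baseChange (κ.layer n)).kummerSelmerStructure
      (p : ℤ)).selmerGroup // ∀ w ∈ T₀, galoisCohomology.localization
        ((W.baseChange (κ.layer n)).torsionGaloisModule (p : ℤ)) (Sum.inr w) 1
        (x : galoisCohomology ((W.baseChange (κ.layer n)).torsionGaloisModule (p : ℤ)) 1) = 0} := by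
    -- `H¹_𝓚(ℚ_n, E[p])` is finite, hence so is the strict subtype
    have hfin : Finite ((W.baseChange (κ.layer n)).kummerSelmerStructure (p : ℤ)).selmerGroup := by
      rw [← selmerGroup_eq_selmerGroup_kummerSelmerStructure]
      exact finite_selmerGroup_holds (W.baseChange (κ.layer n)) (by exact_mod_cast hp.out.ne_zero)
    exact hSel.trans (natCard_strict_le_natCard_strict_baseChange W (κ.layer n)
      (resBaseChangeTorsion_layer_injective W κ n
        (fun P hP ↦ forall_smul_eq_zero_of_not_dvd_torsionOrder W p htors P (by convert hP)))
      S T₀ hT₀S hfin)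
  obtain ⟨s', hs'⟩ := exists_finset_layerZero_of_tamagawaWitnesses_joint (W.baseChange (κ.layer n))
    p hodd (fun Q hQ ↦ hK' Q (by convert hQ)) inv hperf hsum hcompl hEP T₀ hT₀p hwit s hS₀' κ' hκ'c
  obtain ⟨t, ht⟩ := exists_finset_selmerInfty_torsion_of_layerZero W p κ (W.baseChange (κ.layer n))
    κ' (fun Q hQ ↦ hK' Q (by convert hQ)) f hf s'
  exact ⟨t, ht ▸ hs'⟩

end Layer

/-! ### §3 The joint budget at layer `n` from census certificates -/

section Budget

variable {W : WeierstrassCurve ℚ} [W.IsElliptic] [W.IsGloballyMinimal] {p : ℕ} [hp : Fact p.Prime]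

/-- **T-E3g-JOINT at LAYER `n` (r2's ST-21.2 'JOINT-n'): the joint Route-G budget from census
certificates over `ℚ`.** Let `E = W/ℚ` be globally minimal, `p` an odd prime with
`p ∤ #E(ℚ)_tors`, `n : ℕ`, `S` a finite set of places `v` of `ℚ` each with `v ∤ p`, a place-count
certificate `v_p(N(v)^{p−1} − 1) = m_v + 1`, `p ∣ c_v`, and additive OR split multiplicative
reduction at `v`; and let `s` satisfy `p^s ≤ #{x ∈ Sel_p(E/ℚ) : loc_v x = 0 for all v ∈ S}`
(census literal).  Then, modulo Greenberg 4.14 (`h414`), Poitou–Tate duality and the local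
Euler–Poincaré formula over `ℚ_n` (`hPT`, `hEP`) and A40 (`hU`, split rows only):
**`BudgetLeLambdaAt p W (s + Σ_{v ∈ S} p^{min(n, m_v)})`**.  The transport `hres` is row T-res
(`ZpTower.exists_selmerInfty_restrictTower_injective`) by name.
[cite: GreenbergLNM1716, §5 pp. 114–118 and Prop. 4.14] [cite: Washington1997, §13.1 and Prop. 13.2]
[cite: SilvermanATAEC1994, Ch. V Thm. 3.1 (c),(d), Thm. 5.3 (a),(b) and Ex. 5.13] -/
theorem budgetLeLambdaAt_layer_of_certificates_joint (hodd : p ≠ 2)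
    (h414 : Greenberg1999.prop414_noFiniteSubmodule_of_not_dvd_torsionOrder)
    (htors : ¬ p ∣ W.torsionOrder) (hU : Silverman1994_thmV53_tateUniformisation.{0}) (n : ℕ)
    (hPT : ∀ (κ : ZpExtension ℚ p) [NumberField (κ.layer n)], κ.IsCyclotomic →
      poitouTate_selmerStructure_duality (κ.layer n))
    (hEP : ∀ (κ : ZpExtension ℚ p) [NumberField (κ.layer n)], κ.IsCyclotomic →
      ∀ w : HeightOneSpectrum (𝓞 (κ.layer n)),
      localEulerPoincareCharacteristic (w.adicCompletion (κ.layer n)))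
    (S : Finset (HeightOneSpectrum (𝓞 ℚ))) (m : HeightOneSpectrum (𝓞 ℚ) → ℕ)
    (hSp : ∀ v ∈ S, ((p : ℕ) : 𝓞 ℚ) ∉ v.asIdeal)
    (hval : ∀ v ∈ S, padicValNat p (v.residueCard ^ (p - 1) - 1) = m v + 1)
    (hcv : ∀ v ∈ S,
      p ∣ (W.baseChange (v.adicCompletion ℚ)).localTamagawaNumber (v.adicCompletionIntegers ℚ))
    (hdat : ∀ v ∈ S, W.HasAdditiveReductionAt v ∨ W.HasSplitMultiplicativeReductionAt v)
    (s : ℕ) (hSel : p ^ s ≤ Nat.card {x : selmerGroup W (p : ℤ) //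
      ∀ v ∈ S, galoisCohomology.localization (W.torsionGaloisModule (p : ℤ)) (Sum.inr v) 1
        x.1 = 0}) :
    BudgetLeLambdaAt p W (s + ∑ v ∈ S, p ^ min n (m v)) := by
  rw [natCard_strict_selmerGroup_eq] at hSel
  refine budgetLeLambdaAt_of_prop414_of_selmerInftyClasses h414 htors fun κ hκ ↦ ?_
  haveI : NeZero p := ⟨hp.out.ne_zero⟩
  haveI : NumberField (κ.layer n) := numberField_layer κ n
  obtain ⟨κ', hκ', f, hf⟩ := ZpTower.exists_selmerInfty_restrictTower_injective W κ n
  obtain ⟨inv, hperf, hsum, -, hcompl⟩ := hPT κ hκ p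
  -- the witness places of `ℚ_n` above `S`
  obtain ⟨T₀, hcard, hP⟩ := exists_finset_placesOver_card_ge S (fun v ↦ p ^ min n (m v))
    (fun v hv ↦ (pow_min_eq_natCard_placesOver_layer κ hκ hodd n (hSp v hv) (hval v hv)).le)
    (fun w ↦ w.under (𝓞 ℚ) ∈ S ∧ ((p : ℕ) : 𝓞 (κ.layer n)) ∉ w.asIdeal ∧
      ∃ u ∈ unramifiedSubgroup
          (((W.baseChange (κ.layer n)).torsionGaloisModule (p : ℤ)).restrictField
            (w.adicCompletion (κ.layer n))) 1,
        u ∉ (W.baseChange (κ.layer n)).kummerLocalConditionAt (p : ℤ)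
          (w.adicCompletion (κ.layer n)))
    (fun v hv w hw ↦ ⟨hw ▸ hv, natCast_not_mem_asIdeal_of_under_eq (hSp v hv) w hw,
      exists_mem_unramifiedSubgroup_not_mem_kummerLocalConditionAt_layer_of_tamagawaRow hU hodd κ n
        (hSp v hv) (hcv v hv) (hdat v hv) w hw⟩)
  obtain ⟨t, ht⟩ := exists_finset_selmerInfty_torsion_joint_layer hodd htors κ hκ n κ' hκ' f hf inv
    hperf hsum hcompl (hEP κ hκ) S T₀ (fun w hw ↦ (hP w hw).1) (fun w hw ↦ (hP w hw).2.1)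
    (fun w hw ↦ (hP w hw).2.2) s hSel
  refine ⟨t, le_trans ?_ ht⟩
  calc p ^ (s + ∑ v ∈ S, p ^ min n (m v)) ≤ p ^ (s + T₀.card) :=
        Nat.pow_le_pow_right hp.out.pos (Nat.add_le_add_left hcard s)
    _ = p ^ (T₀.card + s) := by rw [Nat.add_comm]

end Budget

end Summit.BirchSwinnertonDyer.Rank1Residual.Additive

end
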